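import Summits.AtomisticToContinuum.HydrodynamicLimit.Theorems.OneFlightGossipEngineEquilibriumClampedCollisionalWindowLDDefs
import Literature.Analysis.FunctionSpaces.HolderNormProofs
import Literature.Analysis.FunctionSpaces.TorusCalculusProofs

/-!
# Second-order Taylor bound on the flat torus (stub `stub_collisionDecomposition`, line `radial-virial-polarization`)

Helper file (`--supports stmt-AtomisticToContinuum-13733`) for the registered stub `stub_collisionDecomposition` (S5) of
the line `radial-virial-polarization` of the crux `EquilibriumClampedCollisionalWindowLD` (repaired statement
`ClampedTransferCoin.RadialVirial.ClampedTransferWindowLD`). For a smooth `φ : 𝕋^d → ℝ` there is `C ≥ 0` with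

  `|φ (x + proj v) - φ x - ∑ l, ∂_l φ (x) v_l| ≤ C ‖v‖²`   for all `x : 𝕋^d`, `v : ℝ^d`

(`exists_taylor_two`), and the same for `φ x - φ (x - proj v)` (`exists_taylor_two_sub`, the form in which the
collision decomposition consumes it: `x_snd = x_fst - proj (ε_N ω̂)`). Proof: the derivative `D (lift φ)` of the
periodic lift is Lipschitz with constant `K = ‖D² (lift φ)‖_∞` (`Torus.IsSmooth.lipschitzWith_iteratedFDeriv_lift`,
tree), so the mean value inequality applied to `y ↦ lift φ y - D(lift φ)(y₀) y` on the ball of radius `‖y₁ - y₀‖`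
gives `|lift φ y₁ - lift φ y₀ - D(lift φ)(y₀)(y₁ - y₀)| ≤ K ‖y₁ - y₀‖²` (`norm_taylor_two_le`); finally
`D(lift φ)(repr x) v = ∑ l, v_l ∂_l φ x` (`Torus.fderiv_lift`, `Torus.fderiv_apply_eq_sum_partialDeriv`).
Registered sub-goal anchoring the file: `collisionDecomposition_taylor_two_sub` (the `𝕋³` case).
-/

noncomputable section

open MeasureTheory Set Filter
open scoped ENNReal NNReal BigOperators
open Literature.Analysis.FluidPDE Literature.MathematicalPhysics.KineticTheory
open Literature.Analysis.FunctionSpaces (Torus.partialDeriv Torus.IsSmooth Torus.proj)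

namespace Summit.AtomisticToContinuum.HydrodynamicLimit.Theorems.ClampedTransferCoin

namespace RadialVirial

namespace CollisionDecomposition

section Normed

variable {E F : Type*} [NormedAddCommGroup E] [NormedSpace ℝ E] [NormedAddCommGroup F] [NormedSpace ℝ F]

/-- The increment of the Fréchet derivative is controlled by the increment of the first iterated derivative
(they are the same map read through the curry isometry). -/
theorem norm_fderiv_sub_le_norm_iteratedFDeriv_one_sub (g : E → F) (y y₀ : E) :
    ‖fderiv ℝ g y - fderiv ℝ g y₀‖ ≤ ‖iteratedFDeriv ℝ 1 g y - iteratedFDeriv ℝ 1 g y₀‖ := by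
  refine ContinuousLinearMap.opNorm_le_bound _ (norm_nonneg _) fun v => ?_
  have h : (fderiv ℝ g y - fderiv ℝ g y₀) v =
      (iteratedFDeriv ℝ 1 g y - iteratedFDeriv ℝ 1 g y₀) (fun _ => v) := by
    simp only [sub_apply, iteratedFDeriv_one_apply]
  rw [h]
  refine (ContinuousMultilinearMap.le_opNorm _ _).trans_eq ?_
  rw [Fin.prod_univ_one]

/-- **Second-order Taylor remainder from a Lipschitz derivative.** If `g` is differentiable and `D¹ g` is
`K`-Lipschitz then `‖g y₁ - g y₀ - Dg(y₀)(y₁ - y₀)‖ ≤ K ‖y₁ - y₀‖²` (mean value inequality for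
`y ↦ g y - Dg(y₀) y` on the closed ball of radius `‖y₁ - y₀‖` about `y₀`). -/
theorem norm_taylor_two_le {g : E → F} (hd : Differentiable ℝ g) {K : ℝ≥0}
    (hK : LipschitzWith K (iteratedFDeriv ℝ 1 g)) (y₀ y₁ : E) :
    ‖g y₁ - g y₀ - fderiv ℝ g y₀ (y₁ - y₀)‖ ≤ K * ‖y₁ - y₀‖ ^ 2 := by
  set r := ‖y₁ - y₀‖ with hr
  set ψ : E → F := fun y => g y - fderiv ℝ g y₀ y with hψ
  have hder : ∀ y ∈ Metric.closedBall y₀ r,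
      HasFDerivWithinAt ψ (fderiv ℝ g y - fderiv ℝ g y₀) (Metric.closedBall y₀ r) y :=
    fun y _ => ((hd y).hasFDerivAt.sub (fderiv ℝ g y₀).hasFDerivAt).hasFDerivWithinAt
  have hbound : ∀ y ∈ Metric.closedBall y₀ r, ‖fderiv ℝ g y - fderiv ℝ g y₀‖ ≤ K * r := fun y hy =>
    (norm_fderiv_sub_le_norm_iteratedFDeriv_one_sub g y y₀).trans
      ((hK.norm_sub_le y y₀).trans (mul_le_mul_of_nonneg_left (mem_closedBall_iff_norm.1 hy) K.2))
  have hmv := (convex_closedBall y₀ r).norm_image_sub_le_of_norm_hasFDerivWithin_le hder hbound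
    (Metric.mem_closedBall_self (norm_nonneg _)) (mem_closedBall_iff_norm.2 le_rfl)
  have hψ' : ψ y₁ - ψ y₀ = g y₁ - g y₀ - fderiv ℝ g y₀ (y₁ - y₀) := by
    simp only [hψ, map_sub]
    abel
  rw [hψ'] at hmv
  calc ‖g y₁ - g y₀ - fderiv ℝ g y₀ (y₁ - y₀)‖ ≤ K * r * ‖y₁ - y₀‖ := hmv
    _ = K * ‖y₁ - y₀‖ ^ 2 := by rw [hr, sq, mul_assoc]

end Normed

section Torus

open Literature.Analysis.FunctionSpaces (Torus.lift Torus.proj Torus.repr Torus.lift_apply Torus.proj_add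
  Torus.proj_neg Torus.proj_repr Torus.fderiv_lift Torus.fderiv_apply_eq_sum_partialDeriv)

variable {d : Type*} [Fintype d] [DecidableEq d]

/-- **Second-order Taylor bound on the torus.** For smooth `φ : 𝕋^d → ℝ` there is `C ≥ 0` with
`|φ (x + proj v) - φ x - ∑ l, ∂_l φ x · v_l| ≤ C ‖v‖²` for all `x`, `v`. -/
theorem exists_taylor_two (φ : UnitAddTorus d → ℝ) (hφ : Torus.IsSmooth φ) :
    ∃ C : ℝ, 0 ≤ C ∧ ∀ (x : UnitAddTorus d) (v : EuclideanSpace ℝ d),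
      |φ (x + Torus.proj v) - φ x - ∑ l, Torus.partialDeriv l φ x * v l| ≤ C * ‖v‖ ^ 2 := by
  obtain ⟨K, hK⟩ : ∃ K : ℝ≥0, LipschitzWith K (iteratedFDeriv ℝ 1 (Torus.lift φ)) :=
    ⟨_, hφ.lipschitzWith_iteratedFDeriv_lift 1⟩
  have h1 : Literature.Analysis.FunctionSpaces.Torus.IsContDiff 1 φ := hφ.isContDiff (by simp)
  have hd : Differentiable ℝ (Torus.lift φ) := ContDiff.differentiable h1 one_ne_zero
  refine ⟨K, K.2, fun x v => ?_⟩
  have h := norm_taylor_two_le hd hK (Torus.repr x) (Torus.repr x + v)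
  have hsum : Literature.Analysis.FunctionSpaces.Torus.fderiv φ x v = ∑ l, Torus.partialDeriv l φ x * v l := by
    rw [Torus.fderiv_apply_eq_sum_partialDeriv h1]
    exact Finset.sum_congr rfl fun l _ => by rw [smul_eq_mul, mul_comm]
  rwa [add_sub_cancel_left, Torus.lift_apply, Torus.lift_apply, Torus.proj_add, Torus.proj_repr, Torus.fderiv_lift,
    Torus.proj_repr, hsum, Real.norm_eq_abs] at h

/-- **Second-order Taylor bound on the torus, backward form**: for smooth `φ : 𝕋^d → ℝ` there is `C ≥ 0` with
`|φ x - φ (x - proj v) - ∑ l, ∂_l φ x · v_l| ≤ C ‖v‖²` for all `x`, `v` (the form `x_snd = x_fst - proj(ε ω̂)`). -/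
theorem exists_taylor_two_sub (φ : UnitAddTorus d → ℝ) (hφ : Torus.IsSmooth φ) :
    ∃ C : ℝ, 0 ≤ C ∧ ∀ (x : UnitAddTorus d) (v : EuclideanSpace ℝ d),
      |φ x - φ (x - Torus.proj v) - ∑ l, Torus.partialDeriv l φ x * v l| ≤ C * ‖v‖ ^ 2 := by
  obtain ⟨C, hC, h⟩ := exists_taylor_two φ hφ
  refine ⟨C, hC, fun x v => ?_⟩
  have h' := h x (-v)
  rw [Torus.proj_neg, ← sub_eq_add_neg, norm_neg] at h'
  have hs : ∑ l, Torus.partialDeriv l φ x * (-v) l = -∑ l, Torus.partialDeriv l φ x * v l := by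
    rw [← Finset.sum_neg_distrib]
    exact Finset.sum_congr rfl fun l _ => by rw [PiLp.neg_apply, mul_neg]
  rw [hs] at h'
  rw [← abs_neg]
  convert h' using 2
  ring

end Torus

end CollisionDecomposition

end RadialVirial

/-- **Registered sub-goal anchoring this file**: the second-order Taylor bound of a smooth function on `𝕋³`, in the
backward form `φ x - φ (x - proj v)` consumed by the collision decomposition (`x_snd = x_fst - proj (ε_N ω̂)`). -/
theorem collisionDecomposition_taylor_two_sub {φ : T3 → ℝ} (hφ : Torus.IsSmooth φ) :
    ∃ C : ℝ, 0 ≤ C ∧ ∀ (x : T3) (v : V3),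
      |φ x - φ (x - Torus.proj v) - ∑ l, Torus.partialDeriv l φ x * v l| ≤ C * ‖v‖ ^ 2 :=
  RadialVirial.CollisionDecomposition.exists_taylor_two_sub φ hφ

end Summit.AtomisticToContinuum.HydrodynamicLimit.Theorems.ClampedTransferCoin

end
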